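import Summits.BirchSwinnertonDyer.BirchSwinnertonDyer.Theorems.KatoDescentPotSupersingularCartanMuRoadRealDoors
import Literature.NumberTheory.IwasawaTheory.ClassicalMuInvariant
import HarnessLib

/-!
# K9 `WildCoatesSujathaResidue` (stmt-19942) / node 19189 / item 19197 — the Cartan μ-road with the `μ`-hypothesis replaced by
# IWASAWA'S 1956 CRITERION on the maximal real subfield `ℚ(W[3])⁺`: class number prime to `3` and a unique prime above `3`
# (cell `bsd-potss`, seat `bsd-potss-k9-c4` g18; route-free; `--supports` 19942 / 19197; closes nothing)

HONEST FRAMING. THEOREMS ONLY (no definition, no named fact, no `sorry`). This seat's `CartanMuRoadRealDoors` (p626162) concludes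
(A) at `(W,3)` / U₀ `MissingUpperBoundAt W 3` from the image predicate and `hμ : μ = 0 for every cyclotomic ℤ_3-extension of K⁺`,
`K⁺ = ℚ(W[3])^c` the maximal real subfield (`= ℚ(P)`, `P` a real `3`-torsion point). Here `hμ` is fed by the NAMED FACT
`iwasawa1956_classNumberPExp_eq_zero_of_not_dvd_classNumber_of_unique_prime` (Iwasawa 1956; Greenberg, *Iwasawa theory — past and
present*, Prop. 2.1; tree corollary `classicalMuVanishes_of_classNumberPExp_eq_zero`): if `3 ∤ h(K⁺)` and `K⁺` has exactly one prime
above `3`, then `μ = λ = ν = 0` for every `ℤ_3`-extension of `K⁺`. So per row the displayed input becomes TWO CLASSICAL NUMERICAL FACTS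
about ONE explicit number field of degree `4` (`3Ns`) or `8` (`3Nn`): its class number mod `3` and the decomposition of `3` — checkable
by PARI/GP (`bnfinit`, `idealprimedec`; this seat's kit job j307465), displayed as hypotheses (class numbers are not kernel-computed).
CONDITIONAL on the named facts; (A), Conjecture A and BSD are proved for no curve here.

References: [Iwasawa1956]; [Greenberg2001IwasawaPastPresent, Prop. 2.1]; [Washington1997, §13.1, Prop. 13.22]; [CoatesSujatha2005, Thm. 3.4];
[Serre1972, §2.2, §5.2 (iv)]; [Kato2004Asterisque, Thm. 14.5 (3)].
-/

set_option linter.dupNamespace false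
set_option autoImplicit false

noncomputable section

open scoped NumberField
open Field IntermediateField WeierstrassCurve Literature.NumberTheory.EllipticCurves
  Literature.NumberTheory.GaloisRepresentations Literature.NumberTheory.SerreUniformity
  Literature.NumberTheory.IwasawaTheory Literature.NumberTheory.EllipticCurves.Rank1Residual.Typed
  Summit.BirchSwinnertonDyer.Rank1Residual.Additive

namespace Summit.BirchSwinnertonDyer.BirchSwinnertonDyer.Theorems.CartanMuRoadRealDoors

variable (W : WeierstrassCurve ℚ) [W.IsElliptic]

/-- **(A) at `(W,3)` on a `3Ns` row from Iwasawa's 1956 criterion on `K⁺ = ℚ(W[3])⁺`** (modulo the named facts Coates–Sujatha Thm. 3.4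
`hCS`, Ferrero–Washington `hFW`, Iwasawa 1956 `hIw`): image in `C_s⁺(3)`, `c` a complex conjugation, `3 ∤ h(K⁺)` (`hh`) and a unique
prime of `K⁺` above `3` (`hv`). [cite: Greenberg2001IwasawaPastPresent, Prop. 2.1 p. 339] [cite: CoatesSujatha2005, Thm. 3.4 (§3)]
[cite: Serre1972, §5.2 (iv)] -/
theorem conjA_three_of_hasSplitCartanNormalizerModPImage_of_realClassNumber
    (hCS : CoatesSujatha2005.thm34_fineSelmerDual_moduleFinite_of_classicalMuVanishes_divisionField)
    (hFW : ferreroWashington1979_classicalMuVanishes)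
    (hIw : iwasawa1956_classNumberPExp_eq_zero_of_not_dvd_classNumber_of_unique_prime)
    (himg : HasSplitCartanNormalizerModPImage W 3) {c : absoluteGaloisGroup ℚ} (hc : IsComplexConjugation (Rat.castHom ℝ) c)
    (hh : haveI : NumberField ↥(W.divisionField 3) := NumberField.mk
      ¬ 3 ∣ NumberField.classNumber ↥(fixedField (Subgroup.zpowers (absRestrictNormalHom (W.divisionField 3) c))))
    (hv : haveI : NumberField ↥(W.divisionField 3) := NumberField.mk
      ∃! v : IsDedekindDomain.HeightOneSpectrum (𝓞 ↥(fixedField (Subgroup.zpowers (absRestrictNormalHom (W.divisionField 3) c)))),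
        ((3 : ℕ) : 𝓞 ↥(fixedField (Subgroup.zpowers (absRestrictNormalHom (W.divisionField 3) c)))) ∈ v.asIdeal)
    (κ : ZpExtension ℚ 3) (hκ : κ.IsCyclotomic) :
    ∃ (γ : absoluteGaloisGroup ℚ) (D : W.FineSelmerDualData κ γ),
      Module.Finite ℤ_[3] (RestrictScalars ℤ_[3] (IwasawaAlgebra 3) D.X) :=
  haveI : NumberField ↥(W.divisionField 3) := NumberField.mk
  conjA_three_of_hasSplitCartanNormalizerModPImage_of_realMu W hCS hFW himg hc
    (fun κE _ => classicalMuVanishes_of_classNumberPExp_eq_zero hIw hh hv κE) κ hκ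

/-- **(A) at `(W,3)` on a `3Nn` row from Iwasawa's 1956 criterion on `K⁺`** (modulo `hCS`, Iwasawa's growth theorem `hI`, `hFW`,
Iwasawa 1956 `hIw`): image `= C_ns⁺(3)`, `c` a complex conjugation, `3 ∤ h(K⁺)`, a unique prime of `K⁺` above `3`.
[cite: Greenberg2001IwasawaPastPresent, Prop. 2.1 p. 339] [cite: CoatesSujatha2005, Thm. 3.4 (§3)] [cite: Washington1997, §13.1] -/
theorem conjA_three_of_hasModPImageEqNonsplitCartanNormalizer_of_realClassNumber
    (hCS : CoatesSujatha2005.thm34_fineSelmerDual_moduleFinite_of_classicalMuVanishes_divisionField)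
    (hI : iwasawa1959_classNumberPExp_growth) (hFW : ferreroWashington1979_classicalMuVanishes)
    (hIw : iwasawa1956_classNumberPExp_eq_zero_of_not_dvd_classNumber_of_unique_prime)
    (himg : HasModPImageEqNonsplitCartanNormalizer W 3) {c : absoluteGaloisGroup ℚ} (hc : IsComplexConjugation (Rat.castHom ℝ) c)
    (hh : haveI : NumberField ↥(W.divisionField 3) := NumberField.mk
      ¬ 3 ∣ NumberField.classNumber ↥(fixedField (Subgroup.zpowers (absRestrictNormalHom (W.divisionField 3) c))))
    (hv : haveI : NumberField ↥(W.divisionField 3) := NumberField.mk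
      ∃! v : IsDedekindDomain.HeightOneSpectrum (𝓞 ↥(fixedField (Subgroup.zpowers (absRestrictNormalHom (W.divisionField 3) c)))),
        ((3 : ℕ) : 𝓞 ↥(fixedField (Subgroup.zpowers (absRestrictNormalHom (W.divisionField 3) c)))) ∈ v.asIdeal)
    (κ : ZpExtension ℚ 3) (hκ : κ.IsCyclotomic) :
    ∃ (γ : absoluteGaloisGroup ℚ) (D : W.FineSelmerDualData κ γ),
      Module.Finite ℤ_[3] (RestrictScalars ℤ_[3] (IwasawaAlgebra 3) D.X) :=
  haveI : NumberField ↥(W.divisionField 3) := NumberField.mk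
  conjA_three_of_hasModPImageEqNonsplitCartanNormalizer_of_realMu' W hCS hI hFW himg hc
    (fun κE _ => classicalMuVanishes_of_classNumberPExp_eq_zero hIw hh hv κE) κ hκ

variable [W.IsGloballyMinimal]

/-- **U₀ at a `3Ns` residue row from Iwasawa's 1956 criterion on `K⁺`**: `MissingUpperBoundAt W 3` for a rank-`0` O6 row with `W[3]`
irreducible and image in `C_s⁺(3)`, from the named facts {A161-fine `hKatoA`, GZK `hGZK`, modularity `hmod`, `hCS`, `hFW`, `hIw`} and the two
classical numerical facts `hh`, `hv` about `K⁺ = ℚ(W[3])⁺`. CONDITIONAL; nothing booked; BSD for no curve.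
[cite: Kato2004Asterisque, Thm. 14.5 (3) (p. 236)] [cite: Greenberg2001IwasawaPastPresent, Prop. 2.1 p. 339] [cite: CoatesSujatha2005, Thm. 3.4 (§3)] -/
theorem missingUpperBoundAt_three_of_hasSplitCartanNormalizerModPImage_of_realClassNumber
    (hKatoA : Kato2004.rankZero_padicValNat_sha_add_padicValNat_tamagawa_le_of_additive_potGood_of_irreducible_of_fineSelmerDual_fg)
    (hGZK : rank_eq_analyticRank_of_analyticRank_le_one) (hmod : hasEntireLFunction_rat)
    (hCS : CoatesSujatha2005.thm34_fineSelmerDual_moduleFinite_of_classicalMuVanishes_divisionField)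
    (hFW : ferreroWashington1979_classicalMuVanishes)
    (hIw : iwasawa1956_classNumberPExp_eq_zero_of_not_dvd_classNumber_of_unique_prime) [Fact (3 : ℕ).Prime]
    (hr : W.analyticRank = 0) (hO : ClassO6 W 3) (hirr : W.HasIrreducibleModPGaloisRep 3)
    (himg : HasSplitCartanNormalizerModPImage W 3) {c : absoluteGaloisGroup ℚ} (hc : IsComplexConjugation (Rat.castHom ℝ) c)
    (hh : haveI : NumberField ↥(W.divisionField 3) := NumberField.mk
      ¬ 3 ∣ NumberField.classNumber ↥(fixedField (Subgroup.zpowers (absRestrictNormalHom (W.divisionField 3) c))))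
    (hv : haveI : NumberField ↥(W.divisionField 3) := NumberField.mk
      ∃! v : IsDedekindDomain.HeightOneSpectrum (𝓞 ↥(fixedField (Subgroup.zpowers (absRestrictNormalHom (W.divisionField 3) c)))),
        ((3 : ℕ) : 𝓞 ↥(fixedField (Subgroup.zpowers (absRestrictNormalHom (W.divisionField 3) c)))) ∈ v.asIdeal) :
    MissingUpperBoundAt W 3 :=
  haveI : NumberField ↥(W.divisionField 3) := NumberField.mk
  missingUpperBoundAt_three_of_hasSplitCartanNormalizerModPImage_of_realMu W hKatoA hGZK hmod hCS hFW hr hO hirr himg hc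
    (fun κE _ => classicalMuVanishes_of_classNumberPExp_eq_zero hIw hh hv κE)

/-- **U₀ at a `3Nn` residue row from Iwasawa's 1956 criterion on `K⁺`** (+ Iwasawa's growth theorem `hI`). CONDITIONAL; nothing booked.
[cite: Kato2004Asterisque, Thm. 14.5 (3) (p. 236)] [cite: Greenberg2001IwasawaPastPresent, Prop. 2.1 p. 339] [cite: CoatesSujatha2005, Thm. 3.4 (§3)] -/
theorem missingUpperBoundAt_three_of_hasModPImageEqNonsplitCartanNormalizer_of_realClassNumber
    (hKatoA : Kato2004.rankZero_padicValNat_sha_add_padicValNat_tamagawa_le_of_additive_potGood_of_irreducible_of_fineSelmerDual_fg)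
    (hGZK : rank_eq_analyticRank_of_analyticRank_le_one) (hmod : hasEntireLFunction_rat)
    (hCS : CoatesSujatha2005.thm34_fineSelmerDual_moduleFinite_of_classicalMuVanishes_divisionField)
    (hI : iwasawa1959_classNumberPExp_growth) (hFW : ferreroWashington1979_classicalMuVanishes)
    (hIw : iwasawa1956_classNumberPExp_eq_zero_of_not_dvd_classNumber_of_unique_prime) [Fact (3 : ℕ).Prime]
    (hr : W.analyticRank = 0) (hO : ClassO6 W 3) (hirr : W.HasIrreducibleModPGaloisRep 3)
    (himg : HasModPImageEqNonsplitCartanNormalizer W 3) {c : absoluteGaloisGroup ℚ} (hc : IsComplexConjugation (Rat.castHom ℝ) c)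
    (hh : haveI : NumberField ↥(W.divisionField 3) := NumberField.mk
      ¬ 3 ∣ NumberField.classNumber ↥(fixedField (Subgroup.zpowers (absRestrictNormalHom (W.divisionField 3) c))))
    (hv : haveI : NumberField ↥(W.divisionField 3) := NumberField.mk
      ∃! v : IsDedekindDomain.HeightOneSpectrum (𝓞 ↥(fixedField (Subgroup.zpowers (absRestrictNormalHom (W.divisionField 3) c)))),
        ((3 : ℕ) : 𝓞 ↥(fixedField (Subgroup.zpowers (absRestrictNormalHom (W.divisionField 3) c)))) ∈ v.asIdeal) :
    MissingUpperBoundAt W 3 :=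
  haveI : NumberField ↥(W.divisionField 3) := NumberField.mk
  missingUpperBoundAt_three_of_hasModPImageEqNonsplitCartanNormalizer_of_realMu' W hKatoA hGZK hmod hCS hI hFW hr hO hirr himg hc
    (fun κE _ => classicalMuVanishes_of_classNumberPExp_eq_zero hIw hh hv κE)

end Summit.BirchSwinnertonDyer.BirchSwinnertonDyer.Theorems.CartanMuRoadRealDoors

end
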